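import Literature.AlgebraicGeometry.Motives.GenericFibreCycles
import Literature.AlgebraicGeometry.Motives.CyclesEquivalencesFlatPullbackProofs
import Literature.AlgebraicGeometry.Motives.SubschemeCyclesFlatPullbackProofs
import Literature.AlgebraicGeometry.Morphisms.GenericFibreSmooth
import HarnessLib

/-!
# The cycle of a closed subscheme restricted to the generic fibre: `[𝒲]_{|X_η} = [𝒲_η]` (Fulton, Lemma 1.7.1 along a flat preimmersion; Bloch, Lemma 1A.1)

Companion to `Literature/AlgebraicGeometry/Motives/GenericFibreCycles` (restriction of cycles
on `X ×ₖ T` to the generic fibre `X_η = pr₂⁻¹(η_T)`, `genericFibreRestrict`) and to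
`…/CyclesEquivalencesFlatPullbackProofs` (Fulton, *Intersection Theory*, Lemma 1.7.1,
`f^*[V] = [f⁻¹(V)]` for `f` flat and locally of finite type, PROVED there). The inclusion of the
generic fibre `ι : X_η ⟶ X ×ₖ T` is flat but not locally of finite type, so the tree's
`flatPullback` does not apply to it and the restriction of cycles along it is the restriction
of coefficient functions `algebraicCycleComap` (Bloch, *Lectures on Algebraic Cycles*,
Lemma 1A.1, proof: "`(X_K)^m = lim_U (X ×_k U)^m`" — the points of `X_K` are the points of
`X × Y` over the generic point). This file proves the corresponding case of Lemma 1.7.1: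

* `algebraicCycleComap_cycle_eq_cycle_preimage`: for a FLAT PREIMMERSION `g : F ⟶ Y` between
  locally Noetherian schemes (injective on points, surjective on stalks; e.g. the inclusion of a
  scheme-theoretic fibre over a point whose local ring is a field) and a closed subscheme
  `V ↪ Y`, the restriction of `[V]` along `g` is the cycle of the inverse image scheme,
  `[V] ∘ g = [g⁻¹(V)]`. Pointwise this is `ℓ(𝒪_{g⁻¹V, w}) = ℓ(𝒪_{V,v}) · ℓ(𝒪_{F,x}/𝔪_{g x}𝒪_{F,x})`
  (the tree's `length_stalk_of_isPullback`, Fulton Lemma A.4.1) with the second factor equal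
  to `1` because `𝔪_{g x}𝒪_{F,x} = 𝔪_x` for a surjective local homomorphism
  (`length_quotient_map_maximalIdeal_eq_one_of_surjective`).
* `flat_fiberι_genericPoint`: the generic fibre `X_η ⟶ X ×ₖ T` is flat (base change of
  `Spec κ(η_T) ⟶ T`, flat as `𝒪_{T,η_T} = k(T)` is a field —
  `Morphisms/GenericFibreSmooth`, `flat_fromSpecResidueField_genericPoint`).
* `genericFibreRestrict_cycle`: **`[𝒲]_{|X_η} = [𝒲_η]`** for a closed subscheme
  `𝒲 ↪ X ×ₖ T` (`T` integral, `X → Spec k` locally of finite type), where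
  `𝒲_η = 𝒲.preimage ι ↪ X_η` is the generic fibre of `𝒲 → T` as a closed subscheme of `X_η`
  — the identification of "`Z` in `CH(Y_η)`" (Voisin 2019, proof of Thm. 2.1) for `Z = [𝒲]`
  with the cycle of the generic fibre of the family, used by the spreading-out step of
  Voisin 2019, Prop. 2.2 (`Voisin2019_genericFibreRatTrivial_spread`,
  `…/BlochSrinivasPrincipleFiniteCoverSteps`).

Everything here is proved; no named facts.

## References

* [Fulton1998] W. Fulton, Intersection Theory, 2nd ed. (1998), Lemma 1.7.1, Lemma A.4.1.
* [BlochLectures2010] S. Bloch, Lectures on Algebraic Cycles, 2nd ed., CUP (2010), Appendix to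
  Lecture 1, Lemma 1A.1 (proof).
* [Voisin2019BirationalDiagonal] C. Voisin, Birational invariants and decomposition of the
  diagonal, LN UMI 26 (2019), Thm. 2.1 (proof), Prop. 2.2.
-/

noncomputable section

universe u

open CategoryTheory CategoryTheory.Limits AlgebraicGeometry Order MonoidalCategory IsLocalRing

namespace Literature.AlgebraicGeometry.Motives

/-! ### The fibre ring of a surjective local homomorphism has length one -/

/-- For a surjective local homomorphism `φ : R → T` of local rings, `𝔪_R T = 𝔪_T` and so
`ℓ_T(T/𝔪_R T) = ℓ_T(κ(T)) = 1`. [folklore] -/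
theorem length_quotient_map_maximalIdeal_eq_one_of_surjective {R T : Type*} [CommRing R]
    [CommRing T] [IsLocalRing R] [IsLocalRing T] (φ : R →+* T) [IsLocalHom φ]
    (hφ : Function.Surjective φ) :
    Module.length T (T ⧸ (maximalIdeal R).map φ) = 1 := by
  set I : Ideal T := (maximalIdeal R).map φ with hI
  have hle : I ≤ maximalIdeal T := by
    rw [hI, Ideal.map_le_iff_le_comap]
    intro r hr
    rw [Ideal.mem_comap, mem_maximalIdeal, mem_nonunits_iff, isUnit_map_iff]
    exact hr
  have hImax : I.IsMaximal := by
    rcases Ideal.map_eq_top_or_isMaximal_of_surjective φ hφ (maximalIdeal.isMaximal R) with h | h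
    · exact absurd (top_le_iff.mp (h ▸ hle : (⊤ : Ideal T) ≤ maximalIdeal T))
        (maximalIdeal.isMaximal T).ne_top
    · exact h
  haveI : IsSimpleModule T (T ⧸ I) :=
    isSimpleModule_iff_quot_maximal.mpr ⟨I, hImax, ⟨LinearEquiv.refl T _⟩⟩
  exact Module.length_eq_one_iff.mpr inferInstance

/-! ### Lemma 1.7.1 along a flat preimmersion -/

section Comap

variable {F Y : Scheme.{u}} (g : F ⟶ Y) [Flat g] [IsPreimmersion g]

/-- **`[V] ∘ g = [g⁻¹(V)]` for a flat preimmersion `g`** (Fulton, *Intersection Theory*,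
Lemma 1.7.1 `f^*[V] = [f⁻¹(V)]`, in the case of a flat morphism injective on points and
surjective on stalks, not necessarily locally of finite type — e.g. the generic fibre
`X_{k(T)} ↪ X ×ₖ T`, Bloch Lemma 1A.1). For `w ∈ g⁻¹(V) = V ×_Y F` over `v ∈ V` and `x ∈ F`:
`ℓ(𝒪_{g⁻¹V,w}) = ℓ(𝒪_{V,v}) · ℓ(𝒪_{F,x}/𝔪_{g x}𝒪_{F,x}) = ℓ(𝒪_{V,v})`
(`length_stalk_of_isPullback`; the fibre ring is the residue field since `g` is surjective on
stalks), and both sides vanish off `g⁻¹(V)`. [cite: Fulton1998, Lemma 1.7.1]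
[cite: BlochLectures2010, Lemma 1A.1] -/
theorem algebraicCycleComap_cycle_eq_cycle_preimage [IsLocallyNoetherian F]
    [IsLocallyNoetherian Y] (hZ : locallyFinsupp_fundamentalCycleFun.{u})
    (V : ClosedSubscheme Y) :
    algebraicCycleComap g g.isEmbedding.injective (V.cycle hZ) = (V.preimage g).cycle hZ := by
  haveI : IsClosedImmersion (pullback.snd V.ι g) := MorphismProperty.pullback_snd _ _ inferInstance
  ext x
  rw [algebraicCycleComap_apply]
  change AlgebraicCycle.map V.ι height height (fundamentalCycle V.carrier hZ) (g x) =
    AlgebraicCycle.map (pullback.snd V.ι g) height height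
      (fundamentalCycle (pullback V.ι g) hZ) x
  by_cases hx : x ∈ Set.range (pullback.snd V.ι g)
  · obtain ⟨w, rfl⟩ := hx
    have hv : g (pullback.snd V.ι g w) = V.ι (pullback.fst V.ι g w) := by
      rw [← Scheme.Hom.comp_apply, ← pullback.condition, Scheme.Hom.comp_apply]
    rw [hv, map_apply_of_isClosedImmersion, map_apply_of_isClosedImmersion,
      fundamentalCycle_apply, fundamentalCycle_apply, fundamentalCycleFun_apply,
      fundamentalCycleFun_apply]
    simp only [stalkLength, Nat.cast_inj]
    congr 1
    rw [length_stalk_of_isPullback (IsPullback.of_hasPullback V.ι g) w _ rfl hv,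
      length_quotient_map_maximalIdeal_eq_one_of_surjective _ (g.stalkMap_surjective _), mul_one]
  · rw [map_apply_of_notMem_range _ _ _ hx]
    have hx' : g x ∉ Set.range V.ι := by
      rwa [Scheme.Pullback.range_snd] at hx
    rw [map_apply_of_notMem_range _ _ _ hx']

end Comap

/-! ### The generic fibre is flat over `X ×ₖ T` -/

section GenericFibre

variable {k : Type u} [Field k] (X T : SchemeOver k) [IsIntegral T.left]

/-- **The generic fibre `X_η ⟶ X ×ₖ T` is flat** (base change of `Spec κ(η_T) ⟶ T`, which is
flat because `𝒪_{T,η_T} = k(T)` is a field — the tree's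
`Literature.AlgebraicGeometry.Morphisms.flat_fromSpecResidueField_genericPoint`). [folklore] -/
theorem flat_fiberι_genericPoint :
    Flat ((CartesianMonoidalCategory.snd X T).left.fiberι (genericPoint T.left)) := by
  haveI := Literature.AlgebraicGeometry.Morphisms.flat_fromSpecResidueField_genericPoint T.left
  exact MorphismProperty.pullback_fst _ _ inferInstance

/-- The generic fibre of `X ×ₖ T → T` is locally Noetherian when `X → Spec k` is locally of
finite type (it is locally of finite type over the field `κ(η_T)`). [folklore] -/
theorem isLocallyNoetherian_fiber_genericPoint [LocallyOfFiniteType X.hom] :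
    IsLocallyNoetherian
      ((CartesianMonoidalCategory.snd X T).left.fiber (genericPoint T.left)) :=
  haveI : LocallyOfFiniteType (CartesianMonoidalCategory.snd X T).left :=
    inferInstanceAs (LocallyOfFiniteType (pullback.snd X.hom T.hom))
  isLocallyNoetherian_fiber _ _

/-- **`[𝒲]_{|X_η} = [𝒲_η]`** (Bloch, Lemma 1A.1, proof; Voisin 2019, proof of Thm. 2.1, "`Z`
… in `CH(Y_η)`" for `Z = [𝒲]`): for a closed subscheme `𝒲 ↪ X ×ₖ T` over an integral `T`,
the restriction of its cycle to the generic fibre `X_η` (`genericFibreRestrict`) is the cycle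
of the closed subscheme `𝒲_η = 𝒲 ×_{X × T} X_η = 𝒲 ×_T Spec k(T) ↪ X_η`
(`ClosedSubscheme.preimage` along `ι : X_η ⟶ X ×ₖ T`) — Lemma 1.7.1 along the flat
preimmersion `ι`. (The generic fibre is locally Noetherian as soon as `X → Spec k` is locally
of finite type, `isLocallyNoetherian_fiber_genericPoint`.) [cite: BlochLectures2010, Lemma 1A.1]
[cite: Fulton1998, Lemma 1.7.1] -/
theorem genericFibreRestrict_cycle [IsLocallyNoetherian (X ⊗ T).left]
    [IsLocallyNoetherian ((CartesianMonoidalCategory.snd X T).left.fiber (genericPoint T.left))]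
    (W : ClosedSubscheme (X ⊗ T).left) [IsLocallyNoetherian W.carrier]
    (hZ : locallyFinsupp_fundamentalCycleFun.{u}) :
    genericFibreRestrict X T (W.cycle hZ) =
      (W.preimage ((CartesianMonoidalCategory.snd X T).left.fiberι (genericPoint T.left))).cycle
        hZ :=
  haveI := flat_fiberι_genericPoint X T
  algebraicCycleComap_cycle_eq_cycle_preimage _ hZ W

end GenericFibre

end Literature.AlgebraicGeometry.Motives

end
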